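import Mathlib
import HarnessLib
import Summits.NavierStokesRegularity.NavierStokesRegularity.Theorems.PoloidalWindowDoorLrcModEntireParallelWebsIdentity

/-!
# Route `PoloidalWindowDoor`, item `LrcModEntire` (stmt-NavierStokesRegularity-20428), cell (Q4-sonic, straight branch, μ(−1,0) < 0) —
# CAUCHY–RIEMANN ON THE WEB SHEET: the horizontal velocity restricted to the sheet is holomorphic in `s + i·d(z)`

Cell ns-regularity-ideate, LEAD-lineage seat ns-poloidal-K2-p3 g17 (`--supports stmt-NavierStokesRegularity-20428`; memo `Cruxes/LrcModEntire/T2B-g17.md` §2(2b),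
brick B-CR; T2B-g16 §5(iii)).  Class-free chain-rule identities.

Setting: a `C¹` vector field `u : ℝ³ → ℝ³` (the slice `U(−1,·)`), a horizontal unit vector `e` with `ν = Je`, and the parallel straight web
`W(s,z) = s·e + d(z)·Je + z·e₂` (`…ParallelWebsIdentity.webMap e (q ↦ d q.2)`).  At a web point `x = W(s,z)` assume the three POINT identities that the tree
supplies on the sonic hot sheet (`…Q4SonicHotSheetNormalForm.sonic_web_point_fderiv_structure`, `…Q4SonicHotSheetPins`): the vertical derivative of the
horizontal velocity vanishes (`⟪Du(x)e₂, e⟫ = ⟪Du(x)e₂, Je⟫ = 0`: slab law `∂₂U_b = μ∂_bU₂` with `∇U₂ = 0`), the horizontal block is symmetric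
(`⟪Du(x)e, Je⟫ = ⟪Du(x)Je, e⟫`: poloidal) and has trace `c` (`= −∂₂U₂(x) = 0` on the hot sheet).  Then for the two sheet functions
`f₁(s,z) = ⟪u(W(s,z)), e⟫`, `f₂(s,z) = ⟪u(W(s,z)), Je⟫`:

* `sheet_CR_fst` — `∂_z f₁ = d′(z)·∂_s f₂`;
* `sheet_CR_snd` — `∂_z f₂ = d′(z)·(c − ∂_s f₁)`;

i.e. for `c = 0`, with `y = d(z)`, `f₁ − i f₂` satisfies the Cauchy–Riemann equations in `s + iy`: the horizontal velocity on the sonic sheet is the boundary value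
of a bounded holomorphic function on the strip `|y| < sup|d|` (memo §2(2b)); its harmonic components carry the web-frame strain `S_{ee} = ∂_s f₁`, `S_{eν} = ∂_s f₂`.

WHAT THIS IS NOT: not a claim about Navier–Stokes regularity and not a stub of the registry; class-free calculus for the residual research cell
`stub_Q4sonicLineNeg` of `Cruxes/LrcModEntire/Lines/twist_split.lean` (bears_on LADDER-NS N0 via item 20428).
-/

noncomputable section

set_option linter.dupNamespace false

namespace Summit.NavierStokesRegularity.NavierStokesRegularity.Theorems.PoloidalWindowDoorLrcModEntireQ4SonicSheetCR

open Set Function Filter Topology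
open scoped RealInnerProductSpace InnerProductSpace
open Summit.NavierStokesRegularity.NavierStokesRegularity.Theorems.PoloidalWindowDoorLrcModEntireSheetFlattenTools
open Summit.NavierStokesRegularity.NavierStokesRegularity.Theorems.PoloidalWindowDoorLrcModEntireParallelWebsIdentity

variable {u : EuclideanSpace ℝ (Fin 3) → EuclideanSpace ℝ (Fin 3)} {e : EuclideanSpace ℝ (Fin 3)} {d : ℝ → ℝ} {p : ℝ × ℝ}

/-- The derivative of a sheet component `q ↦ ⟪u(W q), a⟫` along the parameter direction `h`:
`D⟪u∘W, a⟫(p)[h] = h.1·⟪Du(x)e, a⟫ + d′(p₂)h.2·⟪Du(x)Je, a⟫ + h.2·⟪Du(x)e₂, a⟫`, `x = W(p)`. -/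
theorem fderiv_sheetComponent (hd : DifferentiableAt ℝ d p.2)
    (hu : DifferentiableAt ℝ u (webMap e (fun q : ℝ × ℝ => d q.2) p)) (a : EuclideanSpace ℝ (Fin 3)) (h : ℝ × ℝ) :
    fderiv ℝ (fun q => ⟪u (webMap e (fun q : ℝ × ℝ => d q.2) q), a⟫) p h =
      h.1 * ⟪fderiv ℝ u (webMap e (fun q : ℝ × ℝ => d q.2) p) e, a⟫ +
        deriv d p.2 * h.2 * ⟪fderiv ℝ u (webMap e (fun q : ℝ × ℝ => d q.2) p) (Jvec e), a⟫ +
          h.2 * ⟪fderiv ℝ u (webMap e (fun q : ℝ × ℝ => d q.2) p) e2, a⟫ := by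
  set G : ℝ × ℝ → ℝ := fun q => d q.2 with hG
  set x := webMap e G p with hx
  -- `G = d ∘ snd`
  have hGp' : HasFDerivAt G ((ContinuousLinearMap.smulRight (1 : ℝ →L[ℝ] ℝ) (deriv d p.2)).comp (ContinuousLinearMap.snd ℝ ℝ ℝ)) p :=
    hd.hasDerivAt.hasFDerivAt.comp p hasFDerivAt_snd
  have hGp : DifferentiableAt ℝ G p := hGp'.differentiableAt
  have hGapply : fderiv ℝ G p h = deriv d p.2 * h.2 := by
    rw [hGp'.fderiv]
    simp [mul_comm]
  -- the scalar `g(y) = ⟪u y, a⟫`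
  have hg : DifferentiableAt ℝ (fun y => ⟪u y, a⟫) x := hu.inner ℝ (differentiableAt_const a)
  have hg' : ∀ v, fderiv ℝ (fun y => ⟪u y, a⟫) x v = ⟪fderiv ℝ u x v, a⟫ := by
    intro v
    rw [fderiv_inner_apply ℝ hu (differentiableAt_const a)]
    simp
  rw [fderiv_comp_webMap e hGp hg h, hg', hGapply]
  simp only [map_add, map_smul, inner_add_left, inner_smul_left, conj_trivial]

/-- **CAUCHY–RIEMANN ON THE SHEET, first identity: `∂_z f₁ = d′·∂_s f₂`.** -/
theorem sheet_CR_fst (hd : DifferentiableAt ℝ d p.2)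
    (hu : DifferentiableAt ℝ u (webMap e (fun q : ℝ × ℝ => d q.2) p))
    (hz : ⟪fderiv ℝ u (webMap e (fun q : ℝ × ℝ => d q.2) p) e2, e⟫ = 0)
    (hcurl : ⟪fderiv ℝ u (webMap e (fun q : ℝ × ℝ => d q.2) p) e, Jvec e⟫ =
      ⟪fderiv ℝ u (webMap e (fun q : ℝ × ℝ => d q.2) p) (Jvec e), e⟫) :
    fderiv ℝ (fun q => ⟪u (webMap e (fun q : ℝ × ℝ => d q.2) q), e⟫) p ((0 : ℝ), (1 : ℝ)) =
      deriv d p.2 * fderiv ℝ (fun q => ⟪u (webMap e (fun q : ℝ × ℝ => d q.2) q), Jvec e⟫) p ((1 : ℝ), (0 : ℝ)) := by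
  rw [fderiv_sheetComponent hd hu e, fderiv_sheetComponent hd hu (Jvec e), hz, hcurl]
  ring

/-- **CAUCHY–RIEMANN ON THE SHEET, second identity: `∂_z f₂ = d′·(c − ∂_s f₁)`**, `c` the horizontal trace of `Du` at the web point. -/
theorem sheet_CR_snd (hd : DifferentiableAt ℝ d p.2)
    (hu : DifferentiableAt ℝ u (webMap e (fun q : ℝ × ℝ => d q.2) p))
    (hz : ⟪fderiv ℝ u (webMap e (fun q : ℝ × ℝ => d q.2) p) e2, Jvec e⟫ = 0)
    {c : ℝ} (hdiv : ⟪fderiv ℝ u (webMap e (fun q : ℝ × ℝ => d q.2) p) e, e⟫ +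
      ⟪fderiv ℝ u (webMap e (fun q : ℝ × ℝ => d q.2) p) (Jvec e), Jvec e⟫ = c) :
    fderiv ℝ (fun q => ⟪u (webMap e (fun q : ℝ × ℝ => d q.2) q), Jvec e⟫) p ((0 : ℝ), (1 : ℝ)) =
      deriv d p.2 * (c - fderiv ℝ (fun q => ⟪u (webMap e (fun q : ℝ × ℝ => d q.2) q), e⟫) p ((1 : ℝ), (0 : ℝ))) := by
  rw [fderiv_sheetComponent hd hu (Jvec e), fderiv_sheetComponent hd hu e, hz, ← hdiv]
  ring

/-- **Both Cauchy–Riemann identities at once** on the trace-free (hot) sheet: `∂_z f₁ = d′∂_s f₂` and `∂_z f₂ = −d′∂_s f₁`. -/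
theorem sheet_CR (hd : DifferentiableAt ℝ d p.2)
    (hu : DifferentiableAt ℝ u (webMap e (fun q : ℝ × ℝ => d q.2) p))
    (hz₁ : ⟪fderiv ℝ u (webMap e (fun q : ℝ × ℝ => d q.2) p) e2, e⟫ = 0)
    (hz₂ : ⟪fderiv ℝ u (webMap e (fun q : ℝ × ℝ => d q.2) p) e2, Jvec e⟫ = 0)
    (hcurl : ⟪fderiv ℝ u (webMap e (fun q : ℝ × ℝ => d q.2) p) e, Jvec e⟫ =
      ⟪fderiv ℝ u (webMap e (fun q : ℝ × ℝ => d q.2) p) (Jvec e), e⟫)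
    (hdiv : ⟪fderiv ℝ u (webMap e (fun q : ℝ × ℝ => d q.2) p) e, e⟫ +
      ⟪fderiv ℝ u (webMap e (fun q : ℝ × ℝ => d q.2) p) (Jvec e), Jvec e⟫ = 0) :
    fderiv ℝ (fun q => ⟪u (webMap e (fun q : ℝ × ℝ => d q.2) q), e⟫) p ((0 : ℝ), (1 : ℝ)) =
        deriv d p.2 * fderiv ℝ (fun q => ⟪u (webMap e (fun q : ℝ × ℝ => d q.2) q), Jvec e⟫) p ((1 : ℝ), (0 : ℝ)) ∧
      fderiv ℝ (fun q => ⟪u (webMap e (fun q : ℝ × ℝ => d q.2) q), Jvec e⟫) p ((0 : ℝ), (1 : ℝ)) =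
        -(deriv d p.2 * fderiv ℝ (fun q => ⟪u (webMap e (fun q : ℝ × ℝ => d q.2) q), e⟫) p ((1 : ℝ), (0 : ℝ))) := by
  refine ⟨sheet_CR_fst hd hu hz₁ hcurl, ?_⟩
  rw [sheet_CR_snd hd hu hz₂ hdiv]
  ring

end Summit.NavierStokesRegularity.NavierStokesRegularity.Theorems.PoloidalWindowDoorLrcModEntireQ4SonicSheetCR

end
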